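/-
COR-CM (cell pub-hodgecm2, stage 2 of the Hodge ladder) — count-neutral KERNEL COMBINATORICS «the census → tree TRANSPORT,
orbit-equivariant certificates» (seat prover-pub-hodgecm2-b23-g32-0, binder prover b23, gen 32; claim INT2-TRANSPORT,
HOME/lit/LIT-STATUS.md 2026-08-21T15:20:31Z; sequel of `CorCM/FaceCensusTransport.lean`).  Theorems only; no geometry beyond the
by-name INT-2 consumer; no definition, no named fact, nothing asserted.  Seat b30's engine/checkers are consumed BY NAME; nothing of
theirs is restated or re-filed; `Interfaces.lean` (C1), every E term, B01 and `Transposition/*` are untouched.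
HONEST FRAMING (COORDINATOR RULING — HODGE FRAMING CORRECTION, 2026-08-21T11:55:35Z): `HC_CM` is NOT proved, here or anywhere in
the tree; the closed forms below are CONDITIONAL on face-period witnesses for ONE field.
T5 (coordinator ruling 15:33:56Z (3), lead staging l.4095): no named-fact / conjecture-def / supply binder is introduced; the dictionary
binders are inhabited by transport of structure, the census binders are closed Bool equations discharged per type by `decide`, the
representative faces exist in the kernel (`FaceCensus.exists_face_reads`), and the only remaining hypotheses of the closed forms are the
period witnesses (crux instances) — no contradiction derivable; checker: self (prover-pub-hodgecm2-b23-g32-0), 2026-08-21T17:00Z.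
-/
import Summits.HodgeConjecture.CorCM.FaceCensusTransport
import HarnessLib

/-!
# The census → tree transport for ORBIT-EQUIVARIANT certificates (base-change invariance of the generating module)

Above degree `8` seat b30's census files certify generation modulo divisor pairs in an orbit-equivariant layout
(`Census/DecicFaceSquaresCyclic.lean`, `Census/DuodecicFaceSquares*.lean`: `genOrbitOK`): a `certOK` identity
`1_{corners c} = Σ_i c_i · 1_{corners g_i} + Σ_j d_j · 1_{{P_j, P̄_j}}` for a SHORT list of faces `c`, plus the check that the corner set of
EVERY face is a Galois twist of the corner set of a certified one.  This file transports that layout: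

* §1 **base-change invariance** — mapping every abstract CM type along `Q ∈ GalT F` (`Ψ ↦ pullType (pushType σ₀ Ψ) (Q σ₀) = Ψ·Q⁻¹`)
  sends `weightRel g.corner (fun _ ↦ {σ})` to `weightRel g.corner (fun _ ↦ {Q σ})` and pairs to pairs, so the generating module
  `M(𝒮) = span ℤ {weightRel g.corner (fun _ ↦ {σ}) | g ∈ 𝒮, σ} ⊔ pairRel` is stable and membership of a corner indicator at ONE base
  embedding gives it at ALL (`weightRel_mem_baseChange`);
* §2 **the orbit-equivariant transport** `weightRel_mem_of_certOK_cover` / `hgen_of_certOK_cover`: certified faces `cs` (each in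
  `Γ.faces` with a `certOK` identity over the representatives `reps`), the cover check «every face has the corner set of a twist of a
  certified face» (explicit twist index, normal forms compared — decidable per type), the orbit-cell and pair-label checks of
  `CorCM/FaceCensusTransport.lean`, the dictionary `(Γ, e)` and one face of `𝒮` per representative ⟹ `hgen(𝒮, σ₀)`;
* §3 the CLOSED INT-2 forms on the universe of record, BY NAME over `CorCM/FacePeriodsGeneratingSet.lean`.

References: [QW8] Def. 2.3 / Thm 2.5 and rfwf v3 §8; [cite: Pohlmann1968, Thm. 1]; [cite: Milne1999LefschetzClasses, Thm. 3.2 and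
Cor. 4.5]; [cite: Shimura1998, §6.2 Theorem 3 and §6.1 Corollary of Theorem 2 (pp. 41–43)]; [cite: MumfordAV1970, §19 Thm. 1 and p. 169].
-/

noncomputable section

open NumberField NumberField.ComplexEmbedding
open scoped symmDiff

namespace Summit.HodgeConjecture.CorCM.FaceCensus

open Literature.AlgebraicGeometry.Motives (CMType)
open Literature.NumberTheory.ComplexMultiplication.CMTypeOps
open Summit.HodgeConjecture.CorCM.Prior.AllgGroup.RfwfAllgGroup
open Summit.HodgeConjecture.CorCM.Census.FaceSquaresModel

variable {F : Type} [Field F] [NumberField F] [IsGalois ℚ F]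

/-! ## §1 Base-change invariance of the generating module -/

/-- Base change of abstract CM types along `Q`: `Ψ ↦ Ψ·Q⁻¹ = {P | P Q ∈ Ψ}`, written `pullType (pushType σ₀ Ψ) (Q σ₀)`. [folklore] -/
theorem mem_pullType_pushType (σ₀ : F →+* ℂ) (Ψ : CMF (GalT F) conjT) (Q P : GalT F) :
    P ∈ (pullType (pushType σ₀ Ψ) (Q.1 σ₀)).1 ↔ P * Q ∈ Ψ.1 := by
  rw [mem_pullType]
  change translate σ₀ (P.1 (Q.1 σ₀)) ∈ Ψ.1 ↔ _
  rw [← GalT.mul_apply, translate_apply_eq]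

/-- Base change of a read type: `(pullType Θ σ)·Q⁻¹ = pullType Θ (Q σ)`. [folklore] -/
theorem pullType_pushType_pullType (σ₀ : F →+* ℂ) (Θ : CMType F) (σ : F →+* ℂ) (Q : GalT F) :
    pullType (pushType σ₀ (pullType Θ σ)) (Q.1 σ₀) = pullType Θ (Q.1 σ) := by
  apply Subtype.ext; ext P
  rw [mem_pullType_pushType, mem_pullType, mem_pullType, GalT.mul_apply]

/-- Base change commutes with conjugation. [folklore] -/
theorem pullType_pushType_barCM (σ₀ : F →+* ℂ) (Ψ : CMF (GalT F) conjT) (Q : GalT F) :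
    pullType (pushType σ₀ (barCM Ψ)) (Q.1 σ₀) = barCM (pullType (pushType σ₀ Ψ) (Q.1 σ₀)) := by
  apply Subtype.ext; ext P
  rw [mem_pullType_pushType, mem_barCM, mem_barCM, mem_pullType_pushType]

/-- **Base change of a corner indicator**: mapping every abstract type along `Q` sends `weightRel g.corner (fun _ ↦ {σ})` to
`weightRel g.corner (fun _ ↦ {Q σ})`. [folklore] -/
theorem mapDomain_weightRel_corner (σ₀ : F →+* ℂ) (Q : GalT F) (g : Face F) (σ : F →+* ℂ) :
    Finsupp.mapDomain (fun Ψ => pullType (pushType σ₀ Ψ) (Q.1 σ₀)) (weightRel g.corner (fun _ => ({σ} : Finset (F →+* ℂ)))) =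
      weightRel g.corner (fun _ => ({Q.1 σ} : Finset (F →+* ℂ))) := by
  unfold weightRel
  simp only [Finset.sum_singleton, Finsupp.mapDomain_finsetSum, Finsupp.mapDomain_single, pullType_pushType_pullType]

/-- **The generating module is stable under base change.** [folklore] -/
theorem mapDomain_mem_of_mem (σ₀ : F →+* ℂ) (Q : GalT F) (𝒮 : Set (Face F)) {x : CMF (GalT F) conjT →₀ ℤ}
    (hx : x ∈ Submodule.span ℤ {y : CMF (GalT F) conjT →₀ ℤ | ∃ g ∈ 𝒮, ∃ σ : F →+* ℂ,
        y = weightRel g.corner (fun _ => ({σ} : Finset (F →+* ℂ)))} ⊔ pairRel) :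
    Finsupp.mapDomain (fun Ψ => pullType (pushType σ₀ Ψ) (Q.1 σ₀)) x ∈
      Submodule.span ℤ {y : CMF (GalT F) conjT →₀ ℤ | ∃ g ∈ 𝒮, ∃ σ : F →+* ℂ,
        y = weightRel g.corner (fun _ => ({σ} : Finset (F →+* ℂ)))} ⊔ pairRel := by
  obtain ⟨y, hy, z, hz, rfl⟩ := Submodule.mem_sup.mp hx
  rw [Finsupp.mapDomain_add]
  refine Submodule.add_mem _ (Submodule.mem_sup_left ?_) (Submodule.mem_sup_right ?_)
  · refine Submodule.span_induction (p := fun y _ => Finsupp.mapDomain (fun Ψ => pullType (pushType σ₀ Ψ) (Q.1 σ₀)) y ∈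
        Submodule.span ℤ {y : CMF (GalT F) conjT →₀ ℤ | ∃ g ∈ 𝒮, ∃ σ : F →+* ℂ,
          y = weightRel g.corner (fun _ => ({σ} : Finset (F →+* ℂ)))}) ?_ ?_ ?_ ?_ hy
    · rintro _ ⟨g, hg, σ, rfl⟩
      rw [mapDomain_weightRel_corner]
      exact Submodule.subset_span ⟨g, hg, Q.1 σ, rfl⟩
    · rw [Finsupp.mapDomain_zero]; exact Submodule.zero_mem _
    · intro a b _ _ ha hb; rw [Finsupp.mapDomain_add]; exact Submodule.add_mem _ ha hb
    · intro n a _ ha; rw [Finsupp.mapDomain_smul]; exact Submodule.smul_mem _ n ha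
  · refine Submodule.span_induction (p := fun z _ => Finsupp.mapDomain (fun Ψ => pullType (pushType σ₀ Ψ) (Q.1 σ₀)) z ∈
        (pairRel : Submodule ℤ (CMF (GalT F) conjT →₀ ℤ))) ?_ ?_ ?_ ?_ hz
    · rintro _ ⟨Ψ, rfl⟩
      rw [Finsupp.mapDomain_add, Finsupp.mapDomain_single, Finsupp.mapDomain_single, pullType_pushType_barCM]
      exact Submodule.subset_span ⟨_, rfl⟩
    · rw [Finsupp.mapDomain_zero]; exact Submodule.zero_mem _
    · intro a b _ _ ha hb; rw [Finsupp.mapDomain_add]; exact Submodule.add_mem _ ha hb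
    · intro n a _ ha; rw [Finsupp.mapDomain_smul]; exact Submodule.smul_mem _ n ha

/-- **Membership at one base embedding gives membership at every base embedding.** [folklore] -/
theorem weightRel_mem_baseChange (𝒮 : Set (Face F)) (f : Face F) (σ σ' : F →+* ℂ)
    (h : weightRel f.corner (fun _ => ({σ} : Finset (F →+* ℂ))) ∈
      Submodule.span ℤ {y : CMF (GalT F) conjT →₀ ℤ | ∃ g ∈ 𝒮, ∃ σ : F →+* ℂ,
        y = weightRel g.corner (fun _ => ({σ} : Finset (F →+* ℂ)))} ⊔ pairRel) :
    weightRel f.corner (fun _ => ({σ'} : Finset (F →+* ℂ))) ∈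
      Submodule.span ℤ {y : CMF (GalT F) conjT →₀ ℤ | ∃ g ∈ 𝒮, ∃ σ : F →+* ℂ,
        y = weightRel g.corner (fun _ => ({σ} : Finset (F →+* ℂ)))} ⊔ pairRel := by
  have e : (translate σ σ').1 σ = σ' := translate_apply_self σ σ'
  rw [← e, ← mapDomain_weightRel_corner σ (translate σ σ') f σ]
  exact mapDomain_mem_of_mem σ _ 𝒮 h

/-! ## §2 The orbit-equivariant transport -/

variable {n : ℕ} (Γ : CMGaloisType n) (e : GalT F ≃ Fin n)

/-- Two masks with the same normal form of corner lists have the same corner-set indicator. [folklore] -/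
theorem contains_eq_of_normalize_eq {l l' : List ℕ} (h : Census.FaceSquaresModel.normalize l = Census.FaceSquaresModel.normalize l')
    (S : ℕ) : l.contains S = l'.contains S := by
  apply bool_eq_of_iff
  rw [List.contains_iff_mem, List.contains_iff_mem, ← mem_normalize S l, h, mem_normalize]

/-- **THE ORBIT-EQUIVARIANT TRANSPORT (pre-quotient form).**  Certified faces `cs` — each a face of the model carrying b30's `certOK`
identity over the representatives `reps` — whose twisted corner sets COVER the corner sets of all faces (explicit twist index `j`,
normal forms compared), together with the orbit-cell and pair-label checks, the dictionary `(Γ, e)` and a set `𝒮` of faces of `F`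
containing one face reading as each representative at `σ₀`, give `weightRel f.corner (fun _ ↦ {σ₀}) ∈ span ⊔ pairRel` for EVERY
face `f` of `F`.  (The cover moves the certified face to the base embedding realising the twist; base-change invariance §1 moves it
back.) [cite: Pohlmann1968, Thm. 1] -/
theorem weightRel_mem_of_certOK_cover (hmul : ∀ P Q : GalT F, e (P * Q) = Γ.mul (e P) (e Q)) (hconj : e conjT = Γ.conj)
    (reps : List (ℕ × ℕ × ℕ)) (cs : List ((ℕ × ℕ × ℕ) × List ((ℕ × ℕ × ℕ) × ℤ) × List (ℕ × ℤ)))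
    (hcs : (cs.all fun c => Γ.faces.contains c.1 && Γ.certOK reps c.1 c.2.1 c.2.2) = true)
    (hcover : (Γ.faces.all fun φ => cs.any fun c => (List.finRange n).any fun j =>
      Census.FaceSquaresModel.normalize (Γ.corners φ) ==
        Census.FaceSquaresModel.normalize (Γ.corners (Γ.twist j c.1.1, Γ.twist j c.1.2.1, Γ.twist j c.1.2.2))) = true)
    (horb : (cs.all fun c => c.2.1.all fun gi => reps.any fun r => (List.finRange n).any fun j =>
      [(Γ.twist j r.1, Γ.twist j r.2.1, Γ.twist j r.2.2),
        (flipAt (Γ.twist j r.2.1) (Γ.twist j r.1), Γ.twist j r.2.1, Γ.twist j r.2.2),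
        (flipAt (Γ.twist j r.2.2) (Γ.twist j r.1), Γ.twist j r.2.1, Γ.twist j r.2.2),
        (flipAt (Γ.twist j r.2.2) (flipAt (Γ.twist j r.2.1) (Γ.twist j r.1)), Γ.twist j r.2.1, Γ.twist j r.2.2),
        (Γ.twist j r.1, Γ.twist j r.2.2, Γ.twist j r.2.1),
        (flipAt (Γ.twist j r.2.1) (Γ.twist j r.1), Γ.twist j r.2.2, Γ.twist j r.2.1),
        (flipAt (Γ.twist j r.2.2) (Γ.twist j r.1), Γ.twist j r.2.2, Γ.twist j r.2.1),
        (flipAt (Γ.twist j r.2.2) (flipAt (Γ.twist j r.2.1) (Γ.twist j r.1)), Γ.twist j r.2.2, Γ.twist j r.2.1)].contains gi.1)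
      = true)
    (hpc : (cs.all fun c => c.2.2.all fun pj => Γ.isCMType pj.1) = true)
    (σ₀ : F →+* ℂ) (𝒮 : Set (Face F))
    (hreps : ∀ r ∈ reps, ∃ R ∈ 𝒮, (r.1 < 2 ^ n ∧ ∀ i : Fin n, mem i r.1 = true ↔ e.symm i ∈ (pullType R.Φ σ₀).1) ∧
      Γ.placeMask (e (translate σ₀ R.p)) = r.2.1 ∧ Γ.placeMask (e (translate σ₀ R.p')) = r.2.2)
    (f : Face F) :
    weightRel f.corner (fun _ => ({σ₀} : Finset (F →+* ℂ))) ∈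
      Submodule.span ℤ {y : CMF (GalT F) conjT →₀ ℤ | ∃ g ∈ 𝒮, ∃ σ : F →+* ℂ,
        y = weightRel g.corner (fun _ => ({σ} : Finset (F →+* ℂ)))} ⊔ pairRel := by
  -- the face `f` read at `σ₀`; its cover datum `(c, j)`
  obtain ⟨T, hT⟩ := exists_code e (pullType f.Φ σ₀)
  have hφ := faceCode_mem_faces Γ e hmul hconj f σ₀ hT
  rw [List.all_eq_true] at hcover hcs hpc horb
  obtain ⟨c, hc, hj⟩ := List.any_eq_true.mp (hcover _ hφ)
  obtain ⟨j, -, hnorm⟩ := List.any_eq_true.mp hj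
  rw [beq_iff_eq] at hnorm
  have hc' := hcs c hc
  rw [Bool.and_eq_true] at hc'
  obtain ⟨hcf, hOK⟩ := hc'
  -- a tree face `C` reading as the certified face `c.1` at `σ₀`
  obtain ⟨C, hCT, hCp, hCq⟩ := exists_face_reads Γ e hmul hconj σ₀ (List.contains_iff_mem.mp hcf)
  -- (1) `weightRel C {σ₀}` is certified, hence in the module
  have hgen : ∀ gi ∈ c.2.1, ∃ r ∈ reps, ∃ j : Fin n, gi.1 ∈ [(Γ.twist j r.1, Γ.twist j r.2.1, Γ.twist j r.2.2),
      (flipAt (Γ.twist j r.2.1) (Γ.twist j r.1), Γ.twist j r.2.1, Γ.twist j r.2.2),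
      (flipAt (Γ.twist j r.2.2) (Γ.twist j r.1), Γ.twist j r.2.1, Γ.twist j r.2.2),
      (flipAt (Γ.twist j r.2.2) (flipAt (Γ.twist j r.2.1) (Γ.twist j r.1)), Γ.twist j r.2.1, Γ.twist j r.2.2),
      (Γ.twist j r.1, Γ.twist j r.2.2, Γ.twist j r.2.1),
      (flipAt (Γ.twist j r.2.1) (Γ.twist j r.1), Γ.twist j r.2.2, Γ.twist j r.2.1),
      (flipAt (Γ.twist j r.2.2) (Γ.twist j r.1), Γ.twist j r.2.2, Γ.twist j r.2.1),
      (flipAt (Γ.twist j r.2.2) (flipAt (Γ.twist j r.2.1) (Γ.twist j r.1)), Γ.twist j r.2.2, Γ.twist j r.2.1)] := by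
    intro gi hgi
    have h := List.all_eq_true.mp (horb c hc) gi hgi
    obtain ⟨r, hr, h⟩ := List.any_eq_true.mp h
    obtain ⟨j', -, h⟩ := List.any_eq_true.mp h
    exact ⟨r, hr, j', List.contains_iff_mem.mp h⟩
  have hCmem : weightRel C.corner (fun _ => ({σ₀} : Finset (F →+* ℂ))) ∈
      Submodule.span ℤ {y : CMF (GalT F) conjT →₀ ℤ | ∃ g ∈ 𝒮, ∃ σ : F →+* ℂ,
        y = weightRel g.corner (fun _ => ({σ} : Finset (F →+* ℂ)))} ⊔ pairRel := by
    unfold CMGaloisType.certOK at hOK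
    rw [Bool.and_eq_true, List.all_eq_true, List.all_eq_true] at hOK
    refine mem_of_eval_eq_comboVal Γ e hmul hconj σ₀ 𝒮 reps hreps c.2.1 c.2.2 hgen (List.all_eq_true.mp (hpc c hc)) _
      fun Ψ S hS => ?_
    rw [weightRel_corner_apply Γ e hmul hconj C σ₀ hCT Ψ hS, hCp, hCq]
    exact beq_iff_eq.mp (hOK.2 S (code_mem_cmTypes Γ e hmul hconj hS))
  -- (2) move `C` to the base embedding realising the twist by `g_j`
  set Q : GalT F := (e.symm j)⁻¹ with hQ
  have hjQ : e Q⁻¹ = j := by rw [hQ, inv_inv, e.apply_symm_apply]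
  have hCT' : Γ.twist j c.1.1 < 2 ^ n ∧ ∀ i : Fin n, mem i (Γ.twist j c.1.1) = true ↔ e.symm i ∈ (pullType C.Φ (Q.1 σ₀)).1 := by
    rw [← hjQ]; exact code_pullType_baseChange Γ e hmul C.Φ σ₀ Q hCT
  have hCp' : Γ.placeMask (e (translate (Q.1 σ₀) C.p)) = Γ.twist j c.1.2.1 := by
    rw [placeMask_translate_baseChange Γ e hmul, hjQ, hCp]
  have hCq' : Γ.placeMask (e (translate (Q.1 σ₀) C.p')) = Γ.twist j c.1.2.2 := by
    rw [placeMask_translate_baseChange Γ e hmul, hjQ, hCq]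
  have hCmem' := weightRel_mem_baseChange 𝒮 C σ₀ (Q.1 σ₀) hCmem
  -- (3) `f` at `σ₀` and `C` at `Q σ₀` have the same corner set, hence the same corner indicator
  have heq : weightRel f.corner (fun _ => ({σ₀} : Finset (F →+* ℂ))) =
      weightRel C.corner (fun _ => ({Q.1 σ₀} : Finset (F →+* ℂ))) := by
    ext Ψ
    obtain ⟨S, hS⟩ := exists_code e Ψ
    rw [weightRel_corner_apply Γ e hmul hconj f σ₀ hT Ψ hS, weightRel_corner_apply Γ e hmul hconj C (Q.1 σ₀) hCT' Ψ hS, hCp', hCq',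
      contains_eq_of_normalize_eq hnorm S]
  rw [heq]
  exact hCmem'

/-- **THE ORBIT-EQUIVARIANT TRANSPORT.**  Under the hypotheses of `weightRel_mem_of_certOK_cover`, the generation binder of INT2-GEN
holds: `hgen(𝒮, σ₀)` at every face of `F`. [cite: Pohlmann1968, Thm. 1] [cite: Milne1999LefschetzClasses, Thm. 3.2] -/
theorem hgen_of_certOK_cover (hmul : ∀ P Q : GalT F, e (P * Q) = Γ.mul (e P) (e Q)) (hconj : e conjT = Γ.conj)
    (reps : List (ℕ × ℕ × ℕ)) (cs : List ((ℕ × ℕ × ℕ) × List ((ℕ × ℕ × ℕ) × ℤ) × List (ℕ × ℤ)))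
    (hcs : (cs.all fun c => Γ.faces.contains c.1 && Γ.certOK reps c.1 c.2.1 c.2.2) = true)
    (hcover : (Γ.faces.all fun φ => cs.any fun c => (List.finRange n).any fun j =>
      Census.FaceSquaresModel.normalize (Γ.corners φ) ==
        Census.FaceSquaresModel.normalize (Γ.corners (Γ.twist j c.1.1, Γ.twist j c.1.2.1, Γ.twist j c.1.2.2))) = true)
    (horb : (cs.all fun c => c.2.1.all fun gi => reps.any fun r => (List.finRange n).any fun j =>
      [(Γ.twist j r.1, Γ.twist j r.2.1, Γ.twist j r.2.2),
        (flipAt (Γ.twist j r.2.1) (Γ.twist j r.1), Γ.twist j r.2.1, Γ.twist j r.2.2),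
        (flipAt (Γ.twist j r.2.2) (Γ.twist j r.1), Γ.twist j r.2.1, Γ.twist j r.2.2),
        (flipAt (Γ.twist j r.2.2) (flipAt (Γ.twist j r.2.1) (Γ.twist j r.1)), Γ.twist j r.2.1, Γ.twist j r.2.2),
        (Γ.twist j r.1, Γ.twist j r.2.2, Γ.twist j r.2.1),
        (flipAt (Γ.twist j r.2.1) (Γ.twist j r.1), Γ.twist j r.2.2, Γ.twist j r.2.1),
        (flipAt (Γ.twist j r.2.2) (Γ.twist j r.1), Γ.twist j r.2.2, Γ.twist j r.2.1),
        (flipAt (Γ.twist j r.2.2) (flipAt (Γ.twist j r.2.1) (Γ.twist j r.1)), Γ.twist j r.2.2, Γ.twist j r.2.1)].contains gi.1)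
      = true)
    (hpc : (cs.all fun c => c.2.2.all fun pj => Γ.isCMType pj.1) = true)
    (σ₀ : F →+* ℂ) (𝒮 : Set (Face F))
    (hreps : ∀ r ∈ reps, ∃ R ∈ 𝒮, (r.1 < 2 ^ n ∧ ∀ i : Fin n, mem i r.1 = true ↔ e.symm i ∈ (pullType R.Φ σ₀).1) ∧
      Γ.placeMask (e (translate σ₀ R.p)) = r.2.1 ∧ Γ.placeMask (e (translate σ₀ R.p')) = r.2.2)
    (f : Face F) :
    lefChar f.corner (fun _ => ({σ₀} : Finset (F →+* ℂ))) ∈ AddSubgroup.closure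
      {a : Asym F | ∃ g ∈ 𝒮, ∃ σ : F →+* ℂ, a = lefChar g.corner (fun _ => ({σ} : Finset (F →+* ℂ)))} :=
  hgen_of_weightRel_mem_span 𝒮 σ₀
    (weightRel_mem_of_certOK_cover Γ e hmul hconj reps cs hcs hcover horb hpc σ₀ 𝒮 hreps) f

end Summit.HodgeConjecture.CorCM.FaceCensus

/-! ## §3 INT-2 through the orbit-equivariant transport, CLOSED on the universe of record -/

namespace Summit.HodgeConjecture.CorCM

open CategoryTheory
open Literature.AlgebraicGeometry Literature.AlgebraicGeometry.Motives Literature.AlgebraicGeometry.HodgeTheory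
open Literature.AlgebraicGeometry.ComplexMultiplication Literature.AlgebraicGeometry.Milne1999
open Literature.NumberTheory.Automorphic
open Literature.NumberTheory.Automorphic.PicardCM
open Summit.HodgeConjecture.CorCM.Census.FaceSquaresModel (CMGaloisType mem flipAt)
open Summit.HodgeConjecture.CorCM.Domination

/-- **INT-2 THROUGH THE ORBIT-EQUIVARIANT CENSUS TRANSPORT — period-witness form, CLOSED.**  For ONE Galois CM field `K` enumerated
against a census type certified in the orbit-equivariant layout `(Γ, reps, cs)` and a set `𝒮` of faces of `K` reading as the
representatives at `σ₀`: ONE period witness per face OF `𝒮` on the universe of record implies the Hodge conjecture, in every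
codimension, for every complex abelian variety dominated by a finite product of abelian varieties realising CM types of CM fields
embeddable in `K`.  (FRAMING: conditional on the face periods of `𝒮`; `HC_CM` is not proved.)
[cite: Shimura1998, §6.2 Theorem 3 and §6.1 Corollary of Theorem 2 (pp. 41–43)] [cite: Pohlmann1968, Thm. 1]
[cite: Milne1999LefschetzClasses, Thm. 3.2 and Cor. 4.5] [cite: MumfordAV1970, §19 Thm. 1 and p. 169] -/
theorem hodgeConjectureFor_of_avDominatedBy_isProductOf_of_exists_facePeriod_of_certOK_cover (K : CMField)
    [hGal : IsGalois ℚ K] {n : ℕ} (h6 : 6 ≤ n) (Γ : CMGaloisType n) (e : GalT K ≃ Fin n)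
    (hmul : ∀ P Q : GalT K, e (P * Q) = Γ.mul (e P) (e Q)) (hconj : e conjT = Γ.conj)
    (reps : List (ℕ × ℕ × ℕ)) (cs : List ((ℕ × ℕ × ℕ) × List ((ℕ × ℕ × ℕ) × ℤ) × List (ℕ × ℤ)))
    (hcs : (cs.all fun c => Γ.faces.contains c.1 && Γ.certOK reps c.1 c.2.1 c.2.2) = true)
    (hcover : (Γ.faces.all fun φ => cs.any fun c => (List.finRange n).any fun j =>
      Census.FaceSquaresModel.normalize (Γ.corners φ) ==
        Census.FaceSquaresModel.normalize (Γ.corners (Γ.twist j c.1.1, Γ.twist j c.1.2.1, Γ.twist j c.1.2.2))) = true)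
    (horb : (cs.all fun c => c.2.1.all fun gi => reps.any fun r => (List.finRange n).any fun j =>
      [(Γ.twist j r.1, Γ.twist j r.2.1, Γ.twist j r.2.2),
        (flipAt (Γ.twist j r.2.1) (Γ.twist j r.1), Γ.twist j r.2.1, Γ.twist j r.2.2),
        (flipAt (Γ.twist j r.2.2) (Γ.twist j r.1), Γ.twist j r.2.1, Γ.twist j r.2.2),
        (flipAt (Γ.twist j r.2.2) (flipAt (Γ.twist j r.2.1) (Γ.twist j r.1)), Γ.twist j r.2.1, Γ.twist j r.2.2),
        (Γ.twist j r.1, Γ.twist j r.2.2, Γ.twist j r.2.1),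
        (flipAt (Γ.twist j r.2.1) (Γ.twist j r.1), Γ.twist j r.2.2, Γ.twist j r.2.1),
        (flipAt (Γ.twist j r.2.2) (Γ.twist j r.1), Γ.twist j r.2.2, Γ.twist j r.2.1),
        (flipAt (Γ.twist j r.2.2) (flipAt (Γ.twist j r.2.1) (Γ.twist j r.1)), Γ.twist j r.2.2, Γ.twist j r.2.1)].contains gi.1)
      = true)
    (hpc : (cs.all fun c => c.2.2.all fun pj => Γ.isCMType pj.1) = true)
    (σ₀ : (K : Type) →+* ℂ) (𝒮 : Set (Face K))
    (hreps : ∀ r ∈ reps, ∃ R ∈ 𝒮, (r.1 < 2 ^ n ∧ ∀ i : Fin n, mem i r.1 = true ↔ e.symm i ∈ (pullType R.Φ σ₀).1) ∧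
      Γ.placeMask (e (translate σ₀ R.p)) = r.2.1 ∧ Γ.placeMask (e (translate σ₀ R.p')) = r.2.2)
    (h : ∀ f ∈ 𝒮, ∃ ι₁ : K →+* ℂ, f.Admissible ι₁ ∧ ∃ (V : HermSpace3 K ι₁) (σ : K →+* ℂ),
      (Model.picardCMUniverse exists_isReal_hodgeModel_holds hodgePQ_independent_of_hodgeModel_holds
        BallQuotient.ballQuotientUniformised_holds cmAbelianVarietyRealised_holds).PeriodNV ι₁ V K f.psi σ)
    {P A : AbelianVariety ℂ} (hP : AbelianVariety.IsProductOf (fun B : AbelianVariety ℂ =>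
      ∃ (E : Type) (_ : Field E) (_ : NumberField E) (_ : IsCMField E) (_ : E →+* (K : Type)) (Φ : CMType E)
        (ι : 𝓞 E →+* End B) (θ : E →+* Module.End ℂ (complexBetti B.X 1)),
        IsCMTypeRealisation Φ B ι θ) P)
    (hA : AVDominatedBy A P) : HodgeConjectureFor A.dim A.X :=
  hodgeConjectureFor_of_avDominatedBy_isProductOf_of_exists_facePeriod_on K (h6.trans_eq (FaceCensus.eq_finrank_of_enum e)) 𝒮 σ₀
    (FaceCensus.hgen_of_certOK_cover Γ e hmul hconj reps cs hcs hcover horb hpc σ₀ 𝒮 hreps) h hP hA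

end Summit.HodgeConjecture.CorCM

end
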